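import Mathlib
import Literature.NumberTheory.Sieve.Maynard2016GPYWeights
import Literature.NumberTheory.Sieve.Maynard2016BaseSetCoprime
import Literature.NumberTheory.Sieve.Maynard2016BaseSetClasses
import Literature.NumberTheory.Sieve.Maynard2016SystemUnique
import Literature.NumberTheory.Sieve.Maynard2016ModuliCoprime
import Literature.NumberTheory.Sieve.Maynard2016PwClasses
import HarnessLib

/-!
# Maynard 2016, proof of Lemma 6: the count of one residue system over the range (6.2)–(6.7)

Topic `Literature/NumberTheory/Sieve`. J. Maynard, *Large gaps between primes*, Ann. of Math. (2)
183 (2016), 915–933 = arXiv:1408.5110, §6, displays (6.1)–(6.8).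

Expanding the square in `α_{m,q}⁻¹ = Σ_n (Σ_{d_i ∣ n+h_iq, e_i ∣ m(n+h_iq)−1} λ_{d,e})²` and swapping
the order of summation leaves, for each `(d, d', e, e')`, the number of `n < U/m` with
`(n(mn − 1), P_w) = 1` such that `D_j = [d_j, d'_j] ∣ n + h_j q` and `E_j = [e_j, e'_j] ∣ m(n + h_jq) − 1`
for all `j` (the *joint system* with moduli `D, E`). The source evaluates it "by the
Chinese remainder theorem" (p. 10): there is no contribution unless the `D_j` are pairwise coprime,
the `E_j` are pairwise coprime, everything is coprime to `P_w`, `(E_j, m) = 1` and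
`(D_i, E_j) ∣ mq(h_j − h_i) − 1` — the *solvability conditions* — and then the count is
`(U/m) φ_ω(P_w)/(P_w [D, E]) + O(φ_ω(P_w))`, `φ_ω(P_w) = #{n mod P_w : (n(mn−1), P_w) = 1}`,
`[D, E] = lcm(∏ D_j, ∏ E_j)`.

PROVED here (no named facts), for squarefree moduli:
* `admDE_of_jointSys` — a solution `n` in the range forces the solvability conditions (for `q` prime exceeding the moduli
  and `x` large in the sense of `eventually_coprime_hTuple_sub`);
* `exists_jointSys` — under the conditions the system is solvable (prime-by-prime Chinese remaindering), so it has
  exactly one solution modulo `L = lcm_j [D_j, E_j] = lcm(∏ D_j, ∏ E_j)` (`card_range_filter_jointSys_eq_one`,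
  `lcm_lcm_eq_lcm_prod`);
* `abs_card_filter_jointSys_sub_le` — `|#{n ∈ baseSet : system} − ⌊U/m⌋ φ_ω(P_w)/(P_w [D,E])| ≤ φ_ω(P_w)`.
-/

open Filter Finset
open scoped BigOperators

namespace Literature.NumberTheory.Sieve

namespace Maynard2016

/-! ### The joint system and its solvability conditions -/

/-! Throughout, the *joint system* with moduli `D, E : Fin k → ℕ` is the predicate
`fun n => ∀ j, D j ∣ n + h_j q ∧ E j ∣ m (n + h_j q) − 1` (display (6.2) after expanding the square,
with `D_j = [d_j, d'_j]`, `E_j = [e_j, e'_j]`), and the *solvability conditions* (the dash in (6.8) and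
"there is no contribution unless …", p. 10) are: the `D_j` pairwise coprime, the `E_j` pairwise
coprime, all coprime to `P_w`, `(E_j, m) = 1`, and `(D_i, E_j) ∣ mq(h_j − h_i) − 1` for all `i, j`. -/

/-- `h_j ≥ 1`. [cite: Maynard2016LargeGaps, §4 (definition of h_j)] -/
theorem hTuple_pos (k x : ℕ) (j : Fin k) : 0 < hTuple k x j := by
  unfold hTuple Pw
  exact Nat.mul_pos (Nat.prime_nth_prime _).pos (primorial_pos _)

/-! ### A solution forces the solvability conditions -/

/-- **"No contribution unless …"** (p. 10): if some `n` with `1 ≤ n`, `(n(mn−1), P_w) = 1` solves the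
joint system, `q` is a prime exceeding every modulus, and `x` is large (every integer coprime to
`P_w` is coprime to each `h_j − h_i`), then the solvability conditions hold. [cite: Maynard2016LargeGaps, §6 displays (6.2)–(6.8)] -/
theorem admDE_of_jointSys {k x m q n : ℕ} {C_U ε : ℝ} {D E : Fin k → ℕ} (hq : q.Prime) (hm : 1 ≤ m)
    (hx : ∀ i j : Fin k, i ≠ j → ∀ d : ℕ, Nat.Coprime d (Pw x) →
      Nat.Coprime d ((hTuple k x j : ℤ) - hTuple k x i).natAbs)
    (hD0 : ∀ j, 0 < D j) (hE0 : ∀ j, 0 < E j) (hDq : ∀ j, D j < q) (hEq : ∀ j, E j < q)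
    (hn : n ∈ baseSet C_U ε x m)
    (hsys : ∀ j ∈ (Finset.univ : Finset (Fin k)),
      D j ∣ n + hTuple k x j * q ∧ E j ∣ m * (n + hTuple k x j * q) - 1) :
    (∀ i j : Fin k, i ≠ j → Nat.Coprime (D i) (D j)) ∧
    (∀ i j : Fin k, i ≠ j → Nat.Coprime (E i) (E j)) ∧
    (∀ i : Fin k, Nat.Coprime (D i) (Pw x)) ∧
    (∀ i : Fin k, Nat.Coprime (E i) (Pw x)) ∧
    (∀ i : Fin k, Nat.Coprime (E i) m) ∧
    (∀ i j : Fin k, ((Nat.gcd (D i) (E j) : ℕ) : ℤ) ∣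
      (m : ℤ) * q * ((hTuple k x j : ℤ) - hTuple k x i) - 1) := by
  have hs : ∀ j, D j ∣ n + hTuple k x j * q ∧ E j ∣ m * (n + hTuple k x j * q) - 1 :=
    fun j => hsys j (Finset.mem_univ j)
  have hn1 : 1 ≤ n := (mem_baseSet.1 hn).1.1
  have hpos : ∀ j, 1 ≤ m * (n + hTuple k x j * q) := fun j => Nat.mul_pos hm (by omega)
  have hDP : ∀ i, Nat.Coprime (D i) (Pw x) := fun i => coprime_Pw_of_dvd_add_hTuple_mul hn i (hs i).1
  have hEP : ∀ i, Nat.Coprime (E i) (Pw x) :=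
    fun i => coprime_Pw_of_dvd_mul_add_sub_one hm hn i (hs i).2
  refine ⟨fun i j hij => ?_, fun i j hij => ?_, hDP, hEP, fun i => ?_, fun i j => ?_⟩
  · exact coprime_moduli_of_dvd_add_mul hq (hD0 i) (hDq i) (hs i).1 (hs j).1 (hx i j hij _ (hDP i))
  · exact coprime_moduli_of_dvd_mul_add_mul_sub_one hq (hE0 i) (hEq i) (hpos i) (hpos j)
      (hs i).2 (hs j).2 (hx i j hij _ (hEP i))
  · exact (coprime_of_dvd_mul_sub_one' (hs i).2 (hpos i)).symm
  · set g := Nat.gcd (D i) (E j) with hg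
    have h1 : (g : ℤ) ∣ (m : ℤ) * ((n : ℤ) + hTuple k x i * q) := by
      have : g ∣ m * (n + hTuple k x i * q) :=
        dvd_mul_of_dvd_right (dvd_trans (Nat.gcd_dvd_left _ _) (hs i).1) _
      exact_mod_cast this
    have h2 : (g : ℤ) ∣ (m : ℤ) * ((n : ℤ) + hTuple k x j * q) - 1 := by
      have h := Int.natCast_dvd_natCast.2 (dvd_trans (Nat.gcd_dvd_right (D i) (E j)) (hs j).2)
      rw [Nat.cast_sub (hpos j)] at h
      push_cast at h
      exact h
    have h3 := dvd_sub h2 h1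
    have e : (m : ℤ) * ((n : ℤ) + hTuple k x j * q) - 1 - (m : ℤ) * ((n : ℤ) + hTuple k x i * q) =
        (m : ℤ) * q * ((hTuple k x j : ℤ) - hTuple k x i) - 1 := by ring
    rwa [e] at h3

/-! ### Solvability under the conditions: prime-by-prime Chinese remaindering -/

/-- A local solution at a prime `p`: a residue `a` with `p ∣ a + h_i q` whenever `p ∣ D_i` and
`p ∣ m(a + h_j q) − 1` whenever `p ∣ E_j`. [cite: Maynard2016LargeGaps, §6 display (6.8) («by the Chinese remainder theorem»)] -/
theorem exists_local_solution {k x m q : ℕ} {D E : Fin k → ℕ} (hm : 1 ≤ m) (hq : 0 < q)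
    (hDD : ∀ i j : Fin k, i ≠ j → Nat.Coprime (D i) (D j))
    (hEE : ∀ i j : Fin k, i ≠ j → Nat.Coprime (E i) (E j)) (hEm : ∀ i : Fin k, Nat.Coprime (E i) m)
    (hX : ∀ i j : Fin k, ((Nat.gcd (D i) (E j) : ℕ) : ℤ) ∣
      (m : ℤ) * q * ((hTuple k x j : ℤ) - hTuple k x i) - 1)
    {p : ℕ} (hp : p.Prime) :
    ∃ a : ℕ, (∀ i, p ∣ D i → p ∣ a + hTuple k x i * q) ∧
      (∀ j, p ∣ E j → p ∣ m * (a + hTuple k x j * q) - 1) := by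
  set c : Fin k → ℕ := fun j => hTuple k x j * q with hc
  have hc1 : ∀ j, 1 ≤ c j := fun j => Nat.mul_pos (hTuple_pos k x j) hq
  have hp1 : 1 ≤ p := hp.one_lt.le
  -- `c (p - 1) + c = c p`
  have hcp : ∀ t : ℕ, t * (p - 1) + t = t * p := fun t => by
    rw [Nat.mul_sub_one, Nat.sub_add_cancel (Nat.le_mul_of_pos_right t hp.pos)]
  by_cases hDi : ∃ i, p ∣ D i
  · obtain ⟨i, hi⟩ := hDi
    refine ⟨c i * (p - 1), fun i' hi' => ?_, fun j hj => ?_⟩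
    · -- `i' = i` by coprimality
      have hii : i' = i := by
        by_contra hne
        have h1 := Nat.eq_one_of_dvd_coprimes (hDD i i' (Ne.symm hne)) hi hi'
        exact hp.one_lt.ne' h1
      subst hii
      show p ∣ c i' * (p - 1) + c i'
      rw [hcp]
      exact dvd_mul_left _ _
    · -- the cross condition at `p`
      have hpg : (p : ℤ) ∣ (m : ℤ) * q * ((hTuple k x j : ℤ) - hTuple k x i) - 1 :=
        dvd_trans (Int.natCast_dvd_natCast.2 (Nat.dvd_gcd hi hj)) (hX i j)
      have hle : 1 ≤ m * (c i * (p - 1) + c j) := Nat.mul_pos hm (by have := hc1 j; omega)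
      show p ∣ m * (c i * (p - 1) + c j) - 1
      have key : (p : ℤ) ∣ ((m * (c i * (p - 1) + c j) - 1 : ℕ) : ℤ) := by
        rw [Nat.cast_sub hle]
        push_cast [Nat.cast_sub hp1, hc]
        have e : (m : ℤ) * ((hTuple k x i : ℤ) * q * ((p : ℤ) - 1) + hTuple k x j * q) - 1 =
            (p : ℤ) * (m * (hTuple k x i * q)) +
              ((m : ℤ) * q * ((hTuple k x j : ℤ) - hTuple k x i) - 1) := by ring
        rw [e]
        exact dvd_add (dvd_mul_right _ _) hpg
      exact Int.natCast_dvd_natCast.1 key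
  · by_cases hEj : ∃ j, p ∣ E j
    · obtain ⟨j, hj⟩ := hEj
      have hmp : Nat.Coprime m p := (Nat.Coprime.coprime_dvd_left hj (hEm j)).symm
      obtain ⟨u, -, hu⟩ := Nat.exists_mul_mod_eq_one_of_coprime hmp hp.one_lt
      refine ⟨u + c j * (p - 1), fun i hi => absurd ⟨i, hi⟩ hDi, fun j' hj' => ?_⟩
      have hjj : j' = j := by
        by_contra hne
        have h1 := Nat.eq_one_of_dvd_coprimes (hEE j j' (Ne.symm hne)) hj hj'
        exact hp.one_lt.ne' h1
      subst hjj
      show p ∣ m * (u + c j' * (p - 1) + c j') - 1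
      have hs : u + c j' * (p - 1) + c j' = u + c j' * p := by rw [add_assoc, hcp]
      rw [hs]
      have hu0 : u ≠ 0 := by
        rintro rfl
        rw [mul_zero, Nat.zero_mod] at hu
        exact zero_ne_one hu
      have hle : 1 ≤ m * (u + c j' * p) := Nat.mul_pos hm (by omega)
      have h1 : m * u ≡ 1 [MOD p] := by
        rw [Nat.ModEq, hu, Nat.mod_eq_of_lt hp.one_lt]
      have h2 : m * (u + c j' * p) ≡ m * u [MOD p] := by
        show (m * (u + c j' * p)) % p = (m * u) % p
        rw [mul_add, ← mul_assoc, Nat.add_mul_mod_self_right]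
      exact (Nat.modEq_iff_dvd' hle).1 (h2.trans h1).symm
    · exact ⟨0, fun i hi => absurd ⟨i, hi⟩ hDi, fun j hj => absurd ⟨j, hj⟩ hEj⟩

/-- **Solvability** (the Chinese remainder theorem, p. 10): for squarefree moduli satisfying the solvability conditions
the joint system has a solution. [cite: Maynard2016LargeGaps, §6 display (6.8) («by the Chinese remainder theorem»)] -/
theorem exists_jointSys {k x m q : ℕ} {D E : Fin k → ℕ} (hm : 1 ≤ m) (hq : 0 < q)
    (hDsq : ∀ j, Squarefree (D j)) (hEsq : ∀ j, Squarefree (E j))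
    (hDD : ∀ i j : Fin k, i ≠ j → Nat.Coprime (D i) (D j))
    (hEE : ∀ i j : Fin k, i ≠ j → Nat.Coprime (E i) (E j)) (hEm : ∀ i : Fin k, Nat.Coprime (E i) m)
    (hX : ∀ i j : Fin k, ((Nat.gcd (D i) (E j) : ℕ) : ℤ) ∣
      (m : ℤ) * q * ((hTuple k x j : ℤ) - hTuple k x i) - 1) :
    ∃ n : ℕ, ∀ j ∈ (Finset.univ : Finset (Fin k)),
      D j ∣ n + hTuple k x j * q ∧ E j ∣ m * (n + hTuple k x j * q) - 1 := by
  classical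
  set S : Finset ℕ := Finset.univ.biUnion fun j : Fin k => (D j).primeFactors ∪ (E j).primeFactors
    with hS
  have hprime : ∀ p ∈ S, p.Prime := by
    intro p hp
    rw [hS, Finset.mem_biUnion] at hp
    obtain ⟨j, -, hj⟩ := hp
    rcases Finset.mem_union.1 hj with h | h <;> exact Nat.prime_of_mem_primeFactors h
  have hloc : ∀ p ∈ S, ∃ a : ℕ, (∀ i, p ∣ D i → p ∣ a + hTuple k x i * q) ∧
      (∀ j, p ∣ E j → p ∣ m * (a + hTuple k x j * q) - 1) :=
    fun p hp => exists_local_solution hm hq hDD hEE hEm hX (hprime p hp)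
  choose! a ha using hloc
  have hs0 : ∀ p ∈ S, (fun p : ℕ => p) p ≠ 0 := fun p hp => (hprime p hp).ne_zero
  have hpp : Set.Pairwise (S : Set ℕ) (Function.onFun Nat.Coprime fun p : ℕ => p) := by
    intro p hp p' hp' hne
    exact (Nat.coprime_primes (hprime p hp) (hprime p' hp')).2 hne
  obtain ⟨n, hn⟩ := Nat.chineseRemainderOfFinset a (fun p : ℕ => p) S hs0 hpp
  have hc1 : ∀ j, 1 ≤ hTuple k x j * q := fun j => Nat.mul_pos (hTuple_pos k x j) hq
  refine ⟨n, fun j _ => ⟨?_, ?_⟩⟩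
  · rw [← Nat.prod_primeFactors_of_squarefree (hDsq j)]
    refine Finset.prod_primes_dvd _ (fun p hp => (Nat.prime_of_mem_primeFactors hp).prime)
      fun p hp => ?_
    have hpS : p ∈ S := by
      rw [hS, Finset.mem_biUnion]
      exact ⟨j, Finset.mem_univ j, Finset.mem_union_left _ hp⟩
    have h1 : p ∣ a p + hTuple k x j * q := (ha p hpS).1 j (Nat.dvd_of_mem_primeFactors hp)
    have h2 : n + hTuple k x j * q ≡ a p + hTuple k x j * q [MOD p] := (hn p hpS).add_right _
    exact Nat.modEq_zero_iff_dvd.1 (h2.trans (Nat.modEq_zero_iff_dvd.2 h1))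
  · rw [← Nat.prod_primeFactors_of_squarefree (hEsq j)]
    refine Finset.prod_primes_dvd _ (fun p hp => (Nat.prime_of_mem_primeFactors hp).prime)
      fun p hp => ?_
    have hpS : p ∈ S := by
      rw [hS, Finset.mem_biUnion]
      exact ⟨j, Finset.mem_univ j, Finset.mem_union_right _ hp⟩
    have h1 : p ∣ m * (a p + hTuple k x j * q) - 1 := (ha p hpS).2 j (Nat.dvd_of_mem_primeFactors hp)
    have hle : 1 ≤ m * (a p + hTuple k x j * q) := Nat.mul_pos hm (by have := hc1 j; omega)
    have hle' : 1 ≤ m * (n + hTuple k x j * q) := Nat.mul_pos hm (by have := hc1 j; omega)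
    have hmod : 1 ≡ m * (a p + hTuple k x j * q) [MOD p] := (Nat.modEq_iff_dvd' hle).2 h1
    have h3 : m * (n + hTuple k x j * q) ≡ m * (a p + hTuple k x j * q) [MOD p] :=
      ((hn p hpS).add_right _).mul_left _
    exact (Nat.modEq_iff_dvd' hle').1 (hmod.trans h3.symm)

/-- The period `L = lcm_j [D_j, E_j]` is positive when all moduli are. [cite: Maynard2016LargeGaps, §6 display (6.8)] -/
theorem lcm_lcm_pos {k : ℕ} {D E : Fin k → ℕ} (hD0 : ∀ j, 0 < D j) (hE0 : ∀ j, 0 < E j) :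
    0 < Finset.univ.lcm fun j => Nat.lcm (D j) (E j) := by
  have hdvd : (Finset.univ.lcm fun j => Nat.lcm (D j) (E j)) ∣ ∏ j, D j * E j :=
    Finset.lcm_dvd fun j _ => dvd_trans (Nat.lcm_dvd_mul (D j) (E j))
      (Finset.dvd_prod_of_mem (fun j => D j * E j) (Finset.mem_univ j))
  exact Nat.pos_of_dvd_of_pos hdvd (Finset.prod_pos fun j _ => Nat.mul_pos (hD0 j) (hE0 j))

/-- **Exactly one solution modulo `L = lcm_j [D_j, E_j]`** under the solvability conditions (squarefree moduli,
`m, q ≥ 1`). [cite: Maynard2016LargeGaps, §6 display (6.8) («by the Chinese remainder theorem»)] -/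
theorem card_range_filter_jointSys_eq_one {k x m q : ℕ} {D E : Fin k → ℕ} (hm : 1 ≤ m)
    (hq : 0 < q) (hDsq : ∀ j, Squarefree (D j)) (hEsq : ∀ j, Squarefree (E j))
    (hDD : ∀ i j : Fin k, i ≠ j → Nat.Coprime (D i) (D j))
    (hEE : ∀ i j : Fin k, i ≠ j → Nat.Coprime (E i) (E j)) (hEm : ∀ i : Fin k, Nat.Coprime (E i) m)
    (hX : ∀ i j : Fin k, ((Nat.gcd (D i) (E j) : ℕ) : ℤ) ∣
      (m : ℤ) * q * ((hTuple k x j : ℤ) - hTuple k x i) - 1) :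
    ((Finset.range (Finset.univ.lcm fun j => Nat.lcm (D j) (E j))).filter
        (fun n => ∀ j ∈ (Finset.univ : Finset (Fin k)),
          D j ∣ n + hTuple k x j * q ∧ E j ∣ m * (n + hTuple k x j * q) - 1)).card = 1 := by
  have hc : ∀ j, 1 ≤ hTuple k x j * q := fun j => Nat.mul_pos (hTuple_pos k x j) hq
  refine le_antisymm (card_filter_range_system_le_one D E (fun j => hTuple k x j * q) hm hc) ?_
  obtain ⟨n, hn⟩ := exists_jointSys hm hq hDsq hEsq hDD hEE hEm hX
  have hL := lcm_lcm_pos (fun j => (hDsq j).ne_zero.bot_lt) (fun j => (hEsq j).ne_zero.bot_lt)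
  have hper := periodic_system_lcm D E (fun j => hTuple k x j * q) m hc
  refine Finset.card_pos.2 ⟨n % (Finset.univ.lcm fun j => Nat.lcm (D j) (E j)), ?_⟩
  rw [Finset.mem_filter, Finset.mem_range]
  exact ⟨Nat.mod_lt _ hL, (Iff.of_eq (hper.map_mod_nat n)).2 hn⟩

/-- A product of pairwise coprime naturals each dividing `n` divides `n`. [folklore] -/
private theorem prod_dvd_of_pairwise_coprime {k : ℕ} {f : Fin k → ℕ} {n : ℕ}
    (hcop : ∀ i j : Fin k, i ≠ j → Nat.Coprime (f i) (f j)) (hdvd : ∀ i, f i ∣ n) :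
    ∀ s : Finset (Fin k), ∏ i ∈ s, f i ∣ n := by
  classical
  intro s
  induction s using Finset.induction_on with
  | empty => simp
  | insert a s has ih =>
    rw [Finset.prod_insert has]
    refine Nat.Coprime.mul_dvd_of_dvd_of_dvd ?_ (hdvd a) ih
    exact Nat.Coprime.prod_right fun i hi => hcop a i (fun h => has (h ▸ hi))

/-- `lcm_j [D_j, E_j] = lcm(∏ D_j, ∏ E_j)` when the `D_j` are pairwise coprime and the `E_j` are
pairwise coprime (so `[d,d',e,e']` in (6.8) is this lcm). [cite: Maynard2016LargeGaps, §6 display (6.8)] -/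
theorem lcm_lcm_eq_lcm_prod {k : ℕ} {D E : Fin k → ℕ}
    (hDD : ∀ i j : Fin k, i ≠ j → Nat.Coprime (D i) (D j))
    (hEE : ∀ i j : Fin k, i ≠ j → Nat.Coprime (E i) (E j)) :
    (Finset.univ.lcm fun j => Nat.lcm (D j) (E j)) = Nat.lcm (∏ j, D j) (∏ j, E j) := by
  refine Nat.dvd_antisymm ?_ ?_
  · refine Finset.lcm_dvd fun j _ => Nat.lcm_dvd ?_ ?_
    · exact dvd_trans (Finset.dvd_prod_of_mem D (Finset.mem_univ j)) (Nat.dvd_lcm_left _ _)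
    · exact dvd_trans (Finset.dvd_prod_of_mem E (Finset.mem_univ j)) (Nat.dvd_lcm_right _ _)
  · refine Nat.lcm_dvd ?_ ?_
    · exact prod_dvd_of_pairwise_coprime hDD
        (fun j => dvd_trans (Nat.dvd_lcm_left (D j) (E j))
          (Finset.dvd_lcm (s := Finset.univ) (f := fun j => Nat.lcm (D j) (E j)) (Finset.mem_univ j)))
        Finset.univ
    · exact prod_dvd_of_pairwise_coprime hEE
        (fun j => dvd_trans (Nat.dvd_lcm_right (D j) (E j))
          (Finset.dvd_lcm (s := Finset.univ) (f := fun j => Nat.lcm (D j) (E j)) (Finset.mem_univ j)))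
        Finset.univ

/-- `P_w` is coprime to `L = lcm_j [D_j, E_j]` when every modulus is. [cite: Maynard2016LargeGaps, §6 display (6.8)] -/
theorem coprime_Pw_lcm_lcm {k x : ℕ} {D E : Fin k → ℕ} (hDP : ∀ i, Nat.Coprime (D i) (Pw x))
    (hEP : ∀ i, Nat.Coprime (E i) (Pw x)) :
    (Pw x).Coprime (Finset.univ.lcm fun j => Nat.lcm (D j) (E j)) := by
  have hdvd : (Finset.univ.lcm fun j => Nat.lcm (D j) (E j)) ∣ ∏ j, D j * E j :=
    Finset.lcm_dvd fun j _ => dvd_trans (Nat.lcm_dvd_mul (D j) (E j))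
      (Finset.dvd_prod_of_mem (fun j => D j * E j) (Finset.mem_univ j))
  refine Nat.Coprime.coprime_dvd_right hdvd (Nat.Coprime.prod_right fun j _ => ?_)
  exact Nat.Coprime.mul_right (hDP j).symm (hEP j).symm

/-! ### The count over the base range -/

/-- **The count of the joint system over the range (6.2)–(6.7).** For `m, q ≥ 1` and squarefree
moduli satisfying the solvability conditions:
`|#{n ≤ U/m : (n(mn−1),P_w) = 1, D_j ∣ n+h_jq, E_j ∣ m(n+h_jq)−1 ∀ j} − ⌊U/m⌋ φ_ω(P_w)/(P_w lcm(∏D,∏E))| ≤ φ_ω(P_w)`,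
`φ_ω(P_w) = #{n mod P_w : (n(mn−1), P_w) = 1}` (summing the Chinese-remainder count over the
admissible classes modulo `P_w`, display (6.6)). [cite: Maynard2016LargeGaps, §6 displays (6.2)–(6.7)] -/
theorem abs_card_filter_jointSys_sub_le {k x m q : ℕ} (C_U ε : ℝ) {D E : Fin k → ℕ} (hm : 1 ≤ m)
    (hq : 0 < q) (hDsq : ∀ j, Squarefree (D j)) (hEsq : ∀ j, Squarefree (E j))
    (hDD : ∀ i j : Fin k, i ≠ j → Nat.Coprime (D i) (D j))
    (hEE : ∀ i j : Fin k, i ≠ j → Nat.Coprime (E i) (E j))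
    (hDP : ∀ i : Fin k, Nat.Coprime (D i) (Pw x)) (hEP : ∀ i : Fin k, Nat.Coprime (E i) (Pw x))
    (hEm : ∀ i : Fin k, Nat.Coprime (E i) m)
    (hX : ∀ i j : Fin k, ((Nat.gcd (D i) (E j) : ℕ) : ℤ) ∣
      (m : ℤ) * q * ((hTuple k x j : ℤ) - hTuple k x i) - 1) :
    |((((baseSet C_U ε x m).filter (fun n => ∀ j ∈ (Finset.univ : Finset (Fin k)),
          D j ∣ n + hTuple k x j * q ∧ E j ∣ m * (n + hTuple k x j * q) - 1)).card : ℕ) : ℝ) -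
        (⌊U C_U ε x / m⌋₊ : ℝ) *
          (((Finset.range (Pw x)).filter
              (fun n => Nat.Coprime (n * (m * n - 1)) (Pw x))).card : ℝ) /
            ((Pw x : ℝ) * (Nat.lcm (∏ j, D j) (∏ j, E j) : ℕ))| ≤
      (((Finset.range (Pw x)).filter (fun n => Nat.Coprime (n * (m * n - 1)) (Pw x))).card : ℝ) := by
  classical
  have hP : 0 < Pw x := by unfold Pw; exact primorial_pos _
  have hc : ∀ j, 1 ≤ hTuple k x j * q := fun j => Nat.mul_pos (hTuple_pos k x j) hq
  have hL : 0 < Finset.univ.lcm fun j => Nat.lcm (D j) (E j) :=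
    lcm_lcm_pos (fun j => (hDsq j).ne_zero.bot_lt) (fun j => (hEsq j).ne_zero.bot_lt)
  have hPL : (Pw x).Coprime (Finset.univ.lcm fun j => Nat.lcm (D j) (E j)) :=
    coprime_Pw_lcm_lcm hDP hEP
  have hr := card_range_filter_jointSys_eq_one hm hq hDsq hEsq hDD hEE hEm hX
  have hLL := lcm_lcm_eq_lcm_prod (D := D) (E := E) hDD hEE
  rw [← hLL]
  -- the count as a sum over the admissible classes modulo `P_w`
  have hcount : ∀ (R : ℕ → Prop) [DecidablePred R], ((baseSet C_U ε x m).filter R).card =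
      ∑ α ∈ (Finset.range (Pw x)).filter (fun n => Nat.Coprime (n * (m * n - 1)) (Pw x)),
        ((Finset.Icc 1 ⌊U C_U ε x / m⌋₊).filter (fun n => n % Pw x = α ∧ R n)).card := by
    intro R _
    rw [Finset.card_filter, sum_baseSet_eq_sum_classes hm C_U ε x]
    refine Finset.sum_congr rfl fun α _ => ?_
    rw [Finset.card_filter, Finset.sum_filter]
    refine Finset.sum_congr rfl fun n _ => ?_
    by_cases h1 : n % Pw x = α <;> by_cases h2 : R n <;> simp [h1, h2]
  -- per class: the Chinese remainder count with exactly one solution modulo `L`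
  have hclass : ∀ α ∈ (Finset.range (Pw x)).filter (fun n => Nat.Coprime (n * (m * n - 1)) (Pw x)),
      |((((Finset.Icc 1 ⌊U C_U ε x / m⌋₊).filter
          (fun n => n % Pw x = α ∧ ∀ j ∈ (Finset.univ : Finset (Fin k)),
            D j ∣ n + hTuple k x j * q ∧ E j ∣ m * (n + hTuple k x j * q) - 1)).card : ℕ) : ℝ) -
          (⌊U C_U ε x / m⌋₊ : ℝ) /
            ((Pw x : ℝ) * (Finset.univ.lcm (fun j => Nat.lcm (D j) (E j)) : ℕ))| ≤ 1 := by
    intro α hα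
    have hαP : α < Pw x := Finset.mem_range.1 (Finset.mem_filter.1 hα).1
    have key := abs_card_class_lcm_system_sub_le hP hαP D E (fun j => hTuple k x j * q) hm hc
      hL hPL ⌊U C_U ε x / m⌋₊
    beta_reduce at key
    have hr1 : ((((Finset.range (Finset.univ.lcm fun j => Nat.lcm (D j) (E j))).filter
        (fun n => ∀ j ∈ (Finset.univ : Finset (Fin k)),
          D j ∣ n + hTuple k x j * q ∧ E j ∣ m * (n + hTuple k x j * q) - 1)).card : ℕ) : ℝ) =
        1 := by
      exact_mod_cast hr
    rw [hr1, mul_one] at key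
    exact key
  rw [hcount]
  push_cast
  set A := (Finset.range (Pw x)).filter (fun n => Nat.Coprime (n * (m * n - 1)) (Pw x)) with hAdef
  set T : ℕ → ℝ := fun α => ((((Finset.Icc 1 ⌊U C_U ε x / m⌋₊).filter
      (fun n => n % Pw x = α ∧ ∀ j ∈ (Finset.univ : Finset (Fin k)),
        D j ∣ n + hTuple k x j * q ∧ E j ∣ m * (n + hTuple k x j * q) - 1)).card : ℕ) : ℝ)
    with hT
  set R : ℝ := (⌊U C_U ε x / m⌋₊ : ℝ) /
      ((Pw x : ℝ) * (Finset.univ.lcm (fun j => Nat.lcm (D j) (E j)) : ℕ)) with hR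
  have hclass' : ∀ α ∈ A, |T α - R| ≤ 1 := hclass
  have hsum : ∑ α ∈ A, T α - (⌊U C_U ε x / m⌋₊ : ℝ) * (A.card : ℝ) /
      ((Pw x : ℝ) * (Finset.univ.lcm (fun j => Nat.lcm (D j) (E j)) : ℕ)) =
        ∑ α ∈ A, (T α - R) := by
    rw [Finset.sum_sub_distrib, Finset.sum_const, nsmul_eq_mul, hR]
    ring
  have hgoal : |∑ α ∈ A, T α - (⌊U C_U ε x / m⌋₊ : ℝ) * (A.card : ℝ) /
      ((Pw x : ℝ) * (Finset.univ.lcm (fun j => Nat.lcm (D j) (E j)) : ℕ))| ≤ (A.card : ℝ) := by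
    rw [hsum]
    calc |∑ α ∈ A, (T α - R)| ≤ ∑ α ∈ A, |T α - R| := Finset.abs_sum_le_sum_abs _ _
      _ ≤ ∑ α ∈ A, (1 : ℝ) := Finset.sum_le_sum hclass'
      _ = (A.card : ℝ) := by simp
  simpa [hT] using hgoal

/-- The number of admissible classes is `φ_ω(P_w) = ∏_{p ≤ w}(p − ω_m(p)) ≤ P_w`. [cite: Maynard2016LargeGaps, §6 display (6.6)] -/
theorem card_classes_le_Pw (x m : ℕ) :
    ((Finset.range (Pw x)).filter (fun n => Nat.Coprime (n * (m * n - 1)) (Pw x))).card ≤ Pw x :=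
  (Finset.card_filter_le _ _).trans (by simp)

end Maynard2016

end Literature.NumberTheory.Sieve
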